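import Literature.AnabelianGeometry.AbsoluteAnabelian.OneParameterSubgroupsPSL2RLie
import Literature.Analysis.Matrix.RealExponentialScalarSquare
import Mathlib.Analysis.Normed.Module.Connected
import Mathlib.Topology.Maps.Proper.Basic

/-!
# One-parameter subgroups of `PSL₂(ℝ)`, II: structure of closed connected subgroups
# ([AbsTopIII] Cor. 2.7 (d), PROOF-ONLY infrastructure)

Continuing `OneParameterSubgroupsPSL2RLie.lean` towards the discharge of the named fact
`OneParameterSubgroupsPSL2R` ([MochizukiAbsTopIII2015] Corollary 2.7 (d) p.59). For a CLOSED,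
CONNECTED subgroup `S` of `G = SL₂(ℝ)/{±1}` with Lie algebra `𝔥 ⊆ 𝔰𝔩₂(ℝ)` (part I) we prove the
trichotomy `structure_of_isClosed_of_isConnected`:

* `dim 𝔥 = 0`: `S = 1` (the exponential chart makes `1` isolated in `S`);
* `dim 𝔥 = 1`: `S = {π(exp tX₀) | t ∈ ℝ}` is a one-parameter subgroup, `X₀ ≠ 0` traceless;
* `dim 𝔥 ≥ 2`: `S ∖ {1}` is connected (a punctured neighbourhood of `1` in `S` is the image of a
  punctured ball of `𝔥`, connected in dimension `≥ 2`, and a point with a connected punctured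
  neighbourhood does not disconnect a connected `T₁` space — `isPreconnected_diff_singleton_of_chart`),
  and `𝔥` contains a non-zero NON-ELLIPTIC element (`det X ≤ 0`: the kernel of `X ↦ X₀₁` on `𝔥`).

We also prove that a subgroup whose preimage contains a non-elliptic one-parameter group
`exp(tX)` (`det X ≤ 0`, `X ≠ 0`) is not compact (`not_isCompact_of_nonElliptic`): `π` is proper and
`‖exp (tX)‖` is unbounded by the closed forms of `RealExponentialScalarSquare.lean`
(`cosh`/`1 + tX`).

Everything is a theorem (no definitions, no named facts). No side is taken on anything in
[IUTchIII]; this is classical Lie theory (Hall 2015 [Hall2015], von Neumann 1929) serving a cited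
reconstruction step of [AbsTopIII] §2.
-/

noncomputable section

open NormedSpace Filter Topology Set

namespace Literature.AnabelianGeometry.AbsoluteAnabelian

namespace OneParameterSubgroupsPSL2R

open Matrix Literature.Analysis.Matrix

open scoped MatrixGroups

/-! ### A point with a connected punctured neighbourhood does not disconnect -/

/-- **Cut-point lemma.** In a `T₁` space let `C` be preconnected, `p` a point, `U ∋ p` open and
`E ⊆ C` with `U ∩ C ⊆ E` (a neighbourhood of `p` in `C`) such that `E ∖ {p}` is preconnected. Then
`C ∖ {p}` is preconnected. (If `C ∖ {p} = A ⊔ B` with `E ∖ {p} ⊆ A`, then `B` is clopen in `C`.)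
Used for the one-parameter subgroups of `Aut(𝕍) ≅ SL₂(ℝ)/{±1}`.
[cite: MochizukiAbsTopIII2015, Corollary 2.7 (d) p.59] -/
theorem isPreconnected_diff_singleton_of_chart {α : Type*} [TopologicalSpace α] [T1Space α]
    {C E U : Set α} {p : α} (hC : IsPreconnected C) (hU : IsOpen U) (hpU : p ∈ U)
    (hUE : U ∩ C ⊆ E) (hEC : E ⊆ C) (hE : IsPreconnected (E \ {p})) :
    IsPreconnected (C \ {p}) := by
  rw [isPreconnected_iff_subset_of_disjoint] at hE hC ⊢
  -- the one-sided key step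
  have key : ∀ u v : Set α, IsOpen u → IsOpen v → C \ {p} ⊆ u ∪ v → (C \ {p}) ∩ (u ∩ v) = ∅ →
      E \ {p} ⊆ u → C \ {p} ⊆ u ∨ C \ {p} ⊆ v := by
    intro u v hu hv hsub hdisj hEu
    have hO₂ : IsOpen (v ∩ {p}ᶜ) := hv.inter isOpen_compl_singleton
    have hcov : C ⊆ (u ∪ U) ∪ (v ∩ {p}ᶜ) := by
      intro x hx
      by_cases hxp : x = p
      · exact Or.inl (Or.inr (hxp ▸ hpU))
      · rcases hsub ⟨hx, hxp⟩ with h | h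
        · exact Or.inl (Or.inl h)
        · exact Or.inr ⟨h, hxp⟩
    have hdisj' : C ∩ ((u ∪ U) ∩ (v ∩ {p}ᶜ)) = ∅ := by
      rw [Set.eq_empty_iff_forall_notMem]
      rintro x ⟨hxC, hx1, hxv, hxp⟩
      have hxu : x ∈ u := by
        rcases hx1 with h | h
        · exact h
        · exact hEu ⟨hUE ⟨h, hxC⟩, hxp⟩
      have : x ∈ (C \ {p}) ∩ (u ∩ v) := ⟨⟨hxC, hxp⟩, hxu, hxv⟩
      rw [hdisj] at this
      exact this
    rcases hC _ _ (hu.union hU) hO₂ hcov hdisj' with h | h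
    · left
      rintro x ⟨hxC, hxp⟩
      rcases h hxC with h' | h'
      · exact h'
      · exact hEu ⟨hUE ⟨h', hxC⟩, hxp⟩
    · right
      rintro x ⟨hxC, hxp⟩
      exact (h hxC).1
  intro u v hu hv hsub hdisj
  have hEsub : E \ {p} ⊆ u ∪ v := fun x hx => hsub ⟨hEC hx.1, hx.2⟩
  have hEdisj : (E \ {p}) ∩ (u ∩ v) = ∅ := by
    apply Set.eq_empty_of_subset_empty
    rw [← hdisj]
    exact Set.inter_subset_inter_left _ fun x hx => ⟨hEC hx.1, hx.2⟩
  rcases hE u v hu hv hEsub hEdisj with h | h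
  · exact key u v hu hv hsub hdisj h
  · rw [Set.union_comm] at hsub
    rw [Set.inter_comm u v] at hdisj
    exact (key v u hv hu hsub hdisj h).symm

/-! ### Small traceless matrices are not sent to `±1` by `exp` -/

open scoped Matrix.Norms.Operator

-- As in `Mathlib/Analysis/Normed/Algebra/MatrixExponential.lean` and the tree's `DetExp.lean`: the
-- scoped `L∞`-operator normed ring structure on matrices is only reducibly-defeq to the Pi
-- uniformity, so `CompleteSpace` and the analytic facts about `exp` need this setting.
set_option backward.isDefEq.respectTransparency false

/-- For a traceless `2 × 2` matrix, `det X ≤ ‖X‖²` (`L∞`-operator norm): `det X = -X₀₀² - X₀₁X₁₀`.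
[cite: MochizukiAbsTopIII2015, Corollary 2.7 (d) p.59] -/
theorem det_le_norm_sq (X : Matrix (Fin 2) (Fin 2) ℝ) (hX : X.trace = 0) : X.det ≤ ‖X‖ ^ 2 := by
  rw [Matrix.trace_fin_two] at hX
  have h11 : X 1 1 = -X 0 0 := by linear_combination hX
  rw [Matrix.det_fin_two, h11]
  have h01 : |X 0 1| ≤ ‖X‖ := by
    simpa using Literature.Analysis.Matrix.norm_apply_le_linfty_opNorm X 0 1
  have h10 : |X 1 0| ≤ ‖X‖ := by
    simpa using Literature.Analysis.Matrix.norm_apply_le_linfty_opNorm X 1 0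
  have hprod : -(X 0 1 * X 1 0) ≤ ‖X‖ * ‖X‖ := by
    calc -(X 0 1 * X 1 0) ≤ |X 0 1 * X 1 0| := neg_le_abs _
      _ = |X 0 1| * |X 1 0| := abs_mul _ _
      _ ≤ ‖X‖ * ‖X‖ := mul_le_mul h01 h10 (abs_nonneg _) (norm_nonneg _)
  nlinarith [sq_nonneg (X 0 0)]

/-- **A non-zero traceless `X` with `‖X‖ < 1` has `exp X ∉ {1, -1}`**: by the closed forms for
`2 × 2` traceless exponentials (elliptic: `exp X = ±1` iff `√det X ∈ πℤ`, but `0 < √det X ≤ ‖X‖ < π`;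
non-elliptic: only at `t = 0`). [cite: Hall2015, §2.6 Exercise 6 (2.12) p.47;
MochizukiAbsTopIII2015, Corollary 2.7 (d) p.59] -/
theorem exp_ne_one_and_ne_neg_one (X : Matrix (Fin 2) (Fin 2) ℝ) (hX : X.trace = 0) (hX0 : X ≠ 0) (hXn : ‖X‖ < 1) :
    exp X ≠ 1 ∧ exp X ≠ -1 := by
  rcases le_or_gt X.det 0 with hdet | hdet
  · have h := exp_smul_eq_one_or_neg_one_iff_of_det_nonpos X hX hX0 hdet 1
    rw [one_smul] at h
    constructor
    · intro h1; exact one_ne_zero (h.mp (Or.inl h1))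
    · intro h1; exact one_ne_zero (h.mp (Or.inr h1))
  · have h := exp_smul_eq_one_or_neg_one_iff_of_det_pos X hX hX0 hdet 1
    rw [one_smul, mul_one] at h
    have hsqrt_pos : 0 < Real.sqrt X.det := Real.sqrt_pos.mpr hdet
    have hsqrt_lt : Real.sqrt X.det < Real.pi := by
      have h1 : Real.sqrt X.det ≤ ‖X‖ := by
        rw [← Real.sqrt_sq (norm_nonneg X)]
        exact Real.sqrt_le_sqrt (det_le_norm_sq X hX)
      linarith [Real.two_le_pi]
    have hnot : ¬ ∃ k : ℤ, Real.sqrt X.det = k * Real.pi := by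
      rintro ⟨k, hk⟩
      have hk0 : (0 : ℝ) < (k : ℝ) := by
        by_contra hle
        have hle' : (k : ℝ) ≤ 0 := not_lt.mp hle
        have : (k : ℝ) * Real.pi ≤ 0 := mul_nonpos_of_nonpos_of_nonneg hle' Real.pi_pos.le
        linarith
      have hk1 : (1 : ℝ) ≤ k := by
        have h0 : (0 : ℤ) < k := by exact_mod_cast hk0
        have h1 : (1 : ℤ) ≤ k := h0
        exact_mod_cast h1
      have : Real.pi ≤ Real.sqrt X.det := by rw [hk]; nlinarith [Real.pi_pos]
      linarith
    constructor
    · intro h1; exact hnot (h.mp (Or.inl h1))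
    · intro h1; exact hnot (h.mp (Or.inr h1))

/-! ### The structure of closed connected subgroups of `SL₂(ℝ)/{±1}` -/

/-- **Trichotomy for closed connected subgroups `S ≤ SL₂(ℝ)/{±1}`** according to the dimension of
the Lie algebra `𝔥` of `π⁻¹(S)`: `S` is trivial; or `S` is the one-parameter subgroup `π(exp ℝX₀)` of a
non-zero traceless `X₀`; or (`dim 𝔥 ≥ 2`) `S ∖ {1}` is connected and `𝔥` (with `π(exp tX) ∈ S` for all
`X ∈ 𝔥`, `t ∈ ℝ`) has dimension `≥ 2` and contains a non-zero `X` with `det X ≤ 0`. This is the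
classification behind "the one-parameter subgroups … are precisely the closed connected subgroups
for which the complement of … the identity element fails to be connected".
[cite: MochizukiAbsTopIII2015, Corollary 2.7 (d) p.59] -/
theorem structure_of_isClosed_of_isConnected (S : Subgroup (SL(2, ℝ) ⧸ Subgroup.center SL(2, ℝ))) (hS : IsClosed (S : Set (SL(2, ℝ) ⧸ Subgroup.center SL(2, ℝ))))
    (hconn : IsConnected (S : Set (SL(2, ℝ) ⧸ Subgroup.center SL(2, ℝ)))) :
    S = ⊥ ∨
    (∃ X : (Matrix (Fin 2) (Fin 2) ℝ), X.trace = 0 ∧ X ≠ 0 ∧ ∃ φ : Multiplicative ℝ →* SL(2, ℝ), Continuous φ ∧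
        (∀ t : ℝ, ((φ (Multiplicative.ofAdd t) : SL(2, ℝ)) : Matrix (Fin 2) (Fin 2) ℝ) = exp (t • X)) ∧
        ((QuotientGroup.mk' (Subgroup.center SL(2, ℝ))).comp φ).range = S) ∨
    (IsPreconnected ((Set.univ : Set S) \ {1}) ∧
      ∃ 𝔥 : Submodule ℝ (Matrix (Fin 2) (Fin 2) ℝ),
        (∀ X : (Matrix (Fin 2) (Fin 2) ℝ), X ∈ 𝔥 ↔ ∀ t : ℝ, ∃ g : SL(2, ℝ), (g : Matrix (Fin 2) (Fin 2) ℝ) = exp (t • X) ∧ (g : SL(2, ℝ) ⧸ Subgroup.center SL(2, ℝ)) ∈ S) ∧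
        (∀ X ∈ 𝔥, X.trace = 0) ∧ 2 ≤ Module.finrank ℝ 𝔥 ∧
        ∃ X ∈ 𝔥, X ≠ 0 ∧ X.det ≤ 0) := by
  haveI : IsClosed ((Subgroup.center SL(2, ℝ) : Subgroup SL(2, ℝ)) : Set SL(2, ℝ)) := isClosed_center
  obtain ⟨𝔥, hmem, htr, hchart⟩ := exists_lieAlgebra S hS
  obtain ⟨V, hV, hVchart⟩ := hchart 1 one_pos
  -- an element of `S` in `V` is `π(exp X)` with `X ∈ 𝔥`, `‖X‖ < 1`
  have hV' : ∀ s ∈ S, s ∈ V → ∃ X ∈ 𝔥, ∃ g' : SL(2, ℝ), ‖X‖ < 1 ∧ (g' : Matrix (Fin 2) (Fin 2) ℝ) = exp X ∧ (g' : SL(2, ℝ) ⧸ Subgroup.center SL(2, ℝ)) = s := by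
    intro s hs hsV
    obtain ⟨g, rfl⟩ := QuotientGroup.mk_surjective s
    exact hVchart g hsV hs
  -- membership of `π(exp tX)` for `X ∈ 𝔥`
  have hmemS : ∀ X ∈ 𝔥, ∀ (t : ℝ) (g : SL(2, ℝ)), (g : Matrix (Fin 2) (Fin 2) ℝ) = exp (t • X) → (g : SL(2, ℝ) ⧸ Subgroup.center SL(2, ℝ)) ∈ S := by
    intro X hX t g hg
    obtain ⟨g₁, hg₁, hg₁S⟩ := (hmem X).mp hX t
    have : g = g₁ := Subtype.ext (by rw [hg, hg₁])
    rw [this]; exact hg₁S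
  rcases Nat.lt_or_ge (Module.finrank ℝ 𝔥) 2 with hlt | hge
  · rcases Nat.lt_or_ge (Module.finrank ℝ 𝔥) 1 with hlt1 | hge1
    · -- `dim 𝔥 = 0`: `S` is trivial
      left
      have h𝔥 : 𝔥 = ⊥ := Submodule.finrank_eq_zero.mp (by omega)
      symm
      refine Subgroup.eq_of_isConnected_of_nhds_one S ⊥ bot_le hconn ⟨V, hV, fun s hs hsV => ?_⟩
      obtain ⟨X, hX, g', -, hg', hg's⟩ := hV' s hs hsV
      have hX0 : X = 0 := by rw [h𝔥] at hX; exact (Submodule.mem_bot ℝ).mp hX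
      rw [hX0, NormedSpace.exp_zero] at hg'
      have : g' = 1 := Subtype.ext (by rw [hg']; rfl)
      rw [← hg's, this]
      exact (⊥ : Subgroup (SL(2, ℝ) ⧸ Subgroup.center SL(2, ℝ))).one_mem
    · -- `dim 𝔥 = 1`: a one-parameter subgroup
      right; left
      have h1 : Module.finrank ℝ 𝔥 = 1 := by omega
      obtain ⟨⟨X₀, hX₀⟩, hX₀ne, hspan⟩ := finrank_eq_one_iff'.mp h1
      have hX₀0 : X₀ ≠ 0 := fun h => hX₀ne (Subtype.ext h)
      obtain ⟨φ, hφc, hφ⟩ := exists_expHom X₀ (htr X₀ hX₀)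
      refine ⟨X₀, htr X₀ hX₀, hX₀0, φ, hφc, hφ, ?_⟩
      refine Subgroup.eq_of_isConnected_of_nhds_one S _ ?_ hconn ⟨V, hV, fun s hs hsV => ?_⟩
      · rintro _ ⟨t, rfl⟩
        exact hmemS X₀ hX₀ t.toAdd (φ t) (by simpa using hφ t.toAdd)
      · obtain ⟨X, hX, g', -, hg', hg's⟩ := hV' s hs hsV
        obtain ⟨c, hc⟩ := hspan ⟨X, hX⟩
        have hc' : c • X₀ = X := congrArg Subtype.val hc
        refine ⟨Multiplicative.ofAdd c, ?_⟩
        rw [← hg's]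
        change ((φ (Multiplicative.ofAdd c) : SL(2, ℝ)) : SL(2, ℝ) ⧸ Subgroup.center SL(2, ℝ)) = (g' : SL(2, ℝ) ⧸ Subgroup.center SL(2, ℝ))
        congr 1
        exact Subtype.ext (by rw [hφ c, hc', hg'])
  · -- `dim 𝔥 ≥ 2`
    right; right
    refine ⟨?_, 𝔥, hmem, htr, hge, ?_⟩
    · -- `S ∖ {1}` is preconnected, by the cut-point lemma
      have hrank : 1 < Module.rank ℝ 𝔥 := by
        rw [← Module.finrank_eq_rank]; exact_mod_cast hge
      -- the punctured chart image
      have hdet1 : ∀ X : 𝔥, (exp (X : Matrix (Fin 2) (Fin 2) ℝ)).det = 1 := fun X => by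
        simpa using det_exp_smul_eq_one (X : Matrix (Fin 2) (Fin 2) ℝ) (htr X X.2) 1
      let toSL : 𝔥 → SL(2, ℝ) := fun X => ⟨exp (X : Matrix (Fin 2) (Fin 2) ℝ), hdet1 X⟩
      have htoSL : Continuous toSL := by
        refine continuous_induced_rng.2 ?_
        change Continuous fun X : 𝔥 => exp (X : Matrix (Fin 2) (Fin 2) ℝ)
        exact NormedSpace.exp_continuous.comp continuous_subtype_val
      let F : 𝔥 → (SL(2, ℝ) ⧸ Subgroup.center SL(2, ℝ)) := fun X => (toSL X : SL(2, ℝ) ⧸ Subgroup.center SL(2, ℝ))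
      have hFc : Continuous F :=
        (QuotientGroup.continuous_mk (G := SL(2, ℝ)) (N := Subgroup.center SL(2, ℝ))).comp htoSL
      let Q : Set 𝔥 := (fun q : 𝔥 × ℝ => q.2 • q.1) '' (Metric.sphere (0 : 𝔥) 1 ×ˢ Set.Ioo (0 : ℝ) 1)
      have hQ : IsPreconnected Q :=
        ((isPreconnected_sphere hrank (0 : 𝔥) 1).prod isPreconnected_Ioo).image _
          (by fun_prop : Continuous fun q : 𝔥 × ℝ => q.2 • q.1).continuousOn
      have hQmem : ∀ Y : 𝔥, Y ∈ Q ↔ Y ≠ 0 ∧ ‖Y‖ < 1 := by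
        intro Y
        constructor
        · rintro ⟨⟨v, t⟩, ⟨hv, ht⟩, rfl⟩
          dsimp only at hv ht ⊢
          rw [mem_sphere_zero_iff_norm] at hv
          refine ⟨?_, ?_⟩
          · intro h
            have : ‖t • v‖ = 0 := by rw [h, norm_zero]
            rw [norm_smul, hv, mul_one, Real.norm_eq_abs, abs_of_pos ht.1] at this
            exact ht.1.ne' this
          · rw [norm_smul, hv, mul_one, Real.norm_eq_abs, abs_of_pos ht.1]; exact ht.2
        · rintro ⟨hY0, hY1⟩
          have hYpos : 0 < ‖Y‖ := norm_pos_iff.mpr hY0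
          refine ⟨⟨‖Y‖⁻¹ • Y, ‖Y‖⟩, ⟨?_, hYpos, hY1⟩, ?_⟩
          · rw [mem_sphere_zero_iff_norm, norm_smul, norm_inv, norm_norm,
              inv_mul_cancel₀ hYpos.ne']
          · change ‖Y‖ • (‖Y‖⁻¹ • Y) = Y
            rw [smul_smul, mul_inv_cancel₀ hYpos.ne', one_smul]
      -- `E` = the chart image, `E ∖ {1} = F '' Q`
      let E : Set (SL(2, ℝ) ⧸ Subgroup.center SL(2, ℝ)) := {s | ∃ X ∈ 𝔥, ∃ g' : SL(2, ℝ), ‖X‖ < 1 ∧ (g' : Matrix (Fin 2) (Fin 2) ℝ) = exp X ∧ (g' : SL(2, ℝ) ⧸ Subgroup.center SL(2, ℝ)) = s}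
      have hEQ : E \ {1} = F '' Q := by
        ext s
        constructor
        · rintro ⟨⟨X, hX, g', hXn, hg', hg's⟩, hs1⟩
          refine ⟨⟨X, hX⟩, (hQmem _).mpr ⟨?_, hXn⟩, ?_⟩
          · intro h
            have hX0 : X = 0 := congrArg Subtype.val h
            apply hs1
            rw [Set.mem_singleton_iff, ← hg's]
            have : g' = 1 := Subtype.ext (by rw [hg', hX0, NormedSpace.exp_zero]; rfl)
            rw [this]; rfl
          · rw [← hg's]
            change (toSL ⟨X, hX⟩ : SL(2, ℝ) ⧸ Subgroup.center SL(2, ℝ)) = (g' : SL(2, ℝ) ⧸ Subgroup.center SL(2, ℝ))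
            congr 1
            exact Subtype.ext (by simp [toSL, hg'])
        · rintro ⟨Y, hYQ, rfl⟩
          obtain ⟨hY0, hY1⟩ := (hQmem Y).mp hYQ
          refine ⟨⟨Y, Y.2, toSL Y, hY1, rfl, rfl⟩, ?_⟩
          rw [Set.mem_singleton_iff]
          change ¬ (toSL Y : SL(2, ℝ) ⧸ Subgroup.center SL(2, ℝ)) = 1
          rw [mk_eq_one_iff]
          have hne := exp_ne_one_and_ne_neg_one (Y : Matrix (Fin 2) (Fin 2) ℝ) (htr Y Y.2)
            (fun h => hY0 (Subtype.ext h)) hY1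
          rintro (h | h)
          · exact hne.1 (congrArg Subtype.val h)
          · exact hne.2 (by simpa [toSL] using congrArg Subtype.val h)
      have hEpre : IsPreconnected (E \ {1}) := by
        rw [hEQ]; exact hQ.image F hFc.continuousOn
      have hEC : E ⊆ (S : Set (SL(2, ℝ) ⧸ Subgroup.center SL(2, ℝ))) := by
        rintro s ⟨X, hX, g', -, hg', rfl⟩
        exact hmemS X hX 1 g' (by rw [one_smul, hg'])
      obtain ⟨U, hUV, hUo, h1U⟩ := mem_nhds_iff.mp hV
      have hUE : U ∩ (S : Set (SL(2, ℝ) ⧸ Subgroup.center SL(2, ℝ))) ⊆ E := by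
        rintro s ⟨hsU, hsS⟩
        obtain ⟨X, hX, g', hXn, hg', hg's⟩ := hV' s hsS (hUV hsU)
        exact ⟨X, hX, g', hXn, hg', hg's⟩
      have hpre : IsPreconnected ((S : Set (SL(2, ℝ) ⧸ Subgroup.center SL(2, ℝ))) \ {1}) :=
        isPreconnected_diff_singleton_of_chart hconn.isPreconnected hUo h1U hUE hEC hEpre
      -- transfer to the subtype `S`
      have himg : ((↑) : S → (SL(2, ℝ) ⧸ Subgroup.center SL(2, ℝ))) '' ((Set.univ : Set S) \ {1}) = (S : Set (SL(2, ℝ) ⧸ Subgroup.center SL(2, ℝ))) \ {1} := by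
        ext s
        constructor
        · rintro ⟨x, ⟨-, hx1⟩, rfl⟩
          exact ⟨x.2, fun h => hx1 (Subtype.ext h)⟩
        · rintro ⟨hsS, hs1⟩
          exact ⟨⟨s, hsS⟩, ⟨Set.mem_univ _, fun h => hs1 (congrArg Subtype.val h)⟩, rfl⟩
      refine (Topology.IsInducing.subtypeVal.isPreconnected_image).mp ?_
      exact himg.symm ▸ hpre
    · -- a non-elliptic element: the kernel of `X ↦ X 0 1` on `𝔥` is non-trivial
      let e : 𝔥 →ₗ[ℝ] ℝ :=
        { toFun := fun X => (X : Matrix (Fin 2) (Fin 2) ℝ) 0 1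
          map_add' := fun _ _ => rfl
          map_smul' := fun _ _ => rfl }
      have hker : LinearMap.ker e ≠ ⊥ := by
        intro hbot
        have h1 := LinearMap.finrank_range_add_finrank_ker e
        rw [hbot, finrank_bot, add_zero] at h1
        have h2 : Module.finrank ℝ (LinearMap.range e) ≤ 1 := by
          have := Submodule.finrank_le (LinearMap.range e)
          simpa using this
        omega
      obtain ⟨⟨X, hX⟩, hXker, hXne⟩ := Submodule.exists_mem_ne_zero_of_ne_bot hker
      have hX01 : X 0 1 = 0 := LinearMap.mem_ker.mp hXker
      have hX0 : X ≠ 0 := fun h => hXne (Subtype.ext h)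
      refine ⟨X, hX, hX0, ?_⟩
      have htrX := htr X hX
      rw [Matrix.trace_fin_two] at htrX
      have h11 : X 1 1 = -X 0 0 := by linear_combination htrX
      rw [Matrix.det_fin_two, hX01, h11]
      nlinarith [sq_nonneg (X 0 0)]

/-! ### Non-elliptic one-parameter groups leave every compact set -/

/-- **A subgroup of `SL₂(ℝ)/{±1}` containing a non-elliptic one-parameter group `π(exp ℝX)`
(`X ≠ 0` traceless, `det X ≤ 0`) is not compact**: `π` is proper (closed with finite fibres), so
compactness of `S` would bound `‖exp (tX)‖`, contradicting `exp (tX) = cosh (ωt) 1 + (sinh (ωt)/ω) X`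
(`tr = 2 cosh (ωt)`) resp. `exp (tX) = 1 + tX`. [cite: Hall2015, §2.6 Exercise 6 (2.12) p.47;
MochizukiAbsTopIII2015, Corollary 2.7 (d) p.59] -/
theorem not_isCompact_of_nonElliptic (S : Subgroup (SL(2, ℝ) ⧸ Subgroup.center SL(2, ℝ))) (hK : IsCompact (S : Set (SL(2, ℝ) ⧸ Subgroup.center SL(2, ℝ))))
    (X : Matrix (Fin 2) (Fin 2) ℝ) (hX : X.trace = 0) (hX0 : X ≠ 0) (hdet : X.det ≤ 0)
    (hmemX : ∀ t : ℝ, ∃ g : SL(2, ℝ), (g : Matrix (Fin 2) (Fin 2) ℝ) = exp (t • X) ∧ (g : SL(2, ℝ) ⧸ Subgroup.center SL(2, ℝ)) ∈ S) : False := by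
  haveI : IsClosed ((Subgroup.center SL(2, ℝ) : Subgroup SL(2, ℝ)) : Set SL(2, ℝ)) := isClosed_center
  -- `π` is proper, so `π⁻¹(S)` is compact, hence norm-bounded in `M₂(ℝ)`
  have hproper : IsProperMap ((↑) : SL(2, ℝ) → (SL(2, ℝ) ⧸ Subgroup.center SL(2, ℝ))) := by
    rw [isProperMap_iff_isClosedMap_and_compact_fibers]
    refine ⟨QuotientGroup.continuous_mk, ?_, fun y => ?_⟩
    · refine QuotientGroup.isClosedMap_coe ?_
      have : ((Subgroup.center SL(2, ℝ) : Subgroup SL(2, ℝ)) : Set SL(2, ℝ)) = {1, -1} := by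
        ext g; simp [mem_center_sl_iff]
      rw [this]
      exact (Set.toFinite _).isCompact
    · obtain ⟨g, rfl⟩ := QuotientGroup.mk_surjective y
      have : ((↑) : SL(2, ℝ) → (SL(2, ℝ) ⧸ Subgroup.center SL(2, ℝ))) ⁻¹' {(g : SL(2, ℝ) ⧸ Subgroup.center SL(2, ℝ))} = {g, -g} := by
        ext h
        simp only [Set.mem_preimage, Set.mem_singleton_iff, Set.mem_insert_iff]
        rw [eq_comm, mk_eq_mk_iff]
      rw [this]
      exact (Set.toFinite _).isCompact
  have hKSL : IsCompact (((↑) : SL(2, ℝ) → (SL(2, ℝ) ⧸ Subgroup.center SL(2, ℝ))) ⁻¹' (S : Set (SL(2, ℝ) ⧸ Subgroup.center SL(2, ℝ)))) := hproper.isCompact_preimage hK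
  have hKM : IsCompact (((↑) : SL(2, ℝ) → (Matrix (Fin 2) (Fin 2) ℝ)) '' (((↑) : SL(2, ℝ) → (SL(2, ℝ) ⧸ Subgroup.center SL(2, ℝ))) ⁻¹' (S : Set (SL(2, ℝ) ⧸ Subgroup.center SL(2, ℝ))))) :=
    hKSL.image Matrix.SpecialLinearGroup.isClosedEmbedding_val.continuous
  obtain ⟨C, hC⟩ := hKM.isBounded.exists_norm_le
  have hbound : ∀ t : ℝ, ‖exp (t • X)‖ ≤ C := by
    intro t
    obtain ⟨g, hg, hgS⟩ := hmemX t
    rw [← hg]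
    exact hC _ ⟨g, hgS, rfl⟩
  have hentry : ∀ (t : ℝ) (i j : Fin 2), |(exp (t • X)) i j| ≤ C := fun t i j =>
    le_trans (by simpa using Literature.Analysis.Matrix.norm_apply_le_linfty_opNorm (exp (t • X)) i j)
      (hbound t)
  rcases hdet.lt_or_eq with hlt | heq
  · -- hyperbolic: the trace `2 cosh (ωt)` is unbounded
    set ω := Real.sqrt (-X.det) with hω
    have hωpos : 0 < ω := Real.sqrt_pos.mpr (neg_pos.mpr hlt)
    have htr : ∀ t : ℝ, (exp (t • X)) 0 0 + (exp (t • X)) 1 1 = 2 * Real.cosh (ω * t) := by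
      intro t
      have h := exp_smul_two_of_det_neg X hX hlt t
      rw [Matrix.trace_fin_two] at hX
      have e00 := congrFun (congrFun h 0) 0
      have e11 := congrFun (congrFun h 1) 1
      simp [Matrix.add_apply, Matrix.smul_apply] at e00 e11
      rw [e00, e11]; linear_combination (Real.sinh (ω * t) / ω) * hX
    -- take `t` with `cosh (ω t) > C`
    set t : ℝ := (2 * |C| + 2) / ω with ht
    have hωt : ω * t = 2 * |C| + 2 := by rw [ht]; field_simp
    have hcosh : 2 * |C| + 2 < 2 * Real.cosh (ω * t) := by
      rw [hωt]
      have h1 := Real.add_one_le_exp (2 * |C| + 2)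
      have h2 : Real.exp (2 * |C| + 2) ≤ 2 * Real.cosh (2 * |C| + 2) := by
        rw [Real.cosh_eq]; have := Real.exp_pos (-(2 * |C| + 2)); linarith
      linarith
    have h00 := hentry t 0 0
    have h11 := hentry t 1 1
    have := htr t
    have hC0 : C ≤ |C| := le_abs_self C
    have : (exp (t • X)) 0 0 + (exp (t • X)) 1 1 ≤ 2 * |C| :=
      by linarith [(abs_le.mp h00).2, (abs_le.mp h11).2]
    linarith
  · -- parabolic: `exp (tX) = 1 + tX` has an unbounded entry
    obtain ⟨i, j, hij⟩ : ∃ i j, X i j ≠ 0 := by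
      by_contra h
      simp only [not_exists, not_not] at h
      exact hX0 (Matrix.ext fun i j => by simpa using h i j)
    set t : ℝ := (|C| + 2) / |X i j| with ht
    have hXij : 0 < |X i j| := abs_pos.mpr hij
    have h := hentry t i j
    rw [exp_smul_two_of_det_eq_zero X hX heq t, Matrix.add_apply, Matrix.smul_apply,
      smul_eq_mul] at h
    have h1 : |(1 : Matrix (Fin 2) (Fin 2) ℝ) i j| ≤ 1 := by
      rcases eq_or_ne i j with rfl | hne
      · simp
      · simp [Matrix.one_apply_ne hne]
    have h2 : |t * X i j| = |C| + 2 := by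
      rw [abs_mul, ht, abs_div, abs_abs, abs_of_nonneg (by positivity : (0:ℝ) ≤ |C| + 2)]
      field_simp
    have h3 : |t * X i j| ≤ |(1 : Matrix (Fin 2) (Fin 2) ℝ) i j| + C := by
      have := abs_add_le ((1 : Matrix (Fin 2) (Fin 2) ℝ) i j) (t * X i j)
      have h4 : |t * X i j| - |(1 : Matrix (Fin 2) (Fin 2) ℝ) i j| ≤ |(1 : Matrix (Fin 2) (Fin 2) ℝ) i j + t * X i j| := by
        have := abs_sub_abs_le_abs_sub (t * X i j) (-(1 : Matrix (Fin 2) (Fin 2) ℝ) i j)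
        simp only [abs_neg, sub_neg_eq_add] at this
        rw [add_comm] at this
        linarith
      linarith
    linarith [le_abs_self C]

end OneParameterSubgroupsPSL2R

end Literature.AnabelianGeometry.AbsoluteAnabelian

end
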